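import Literature.NumberTheory.EllipticCurves.Kato2004.IwasawaH1ReductionTower
import Literature.NumberTheory.EllipticCurves.Kato2004.IwasawaH1ReductionPk
import Literature.NumberTheory.EllipticCurves.IwasawaTwistModPkTower
import HarnessLib

/-!
# Kato 2004 §13.8 / §12.2 at level `p^k`: the `(ℤ/p^k)⟦T⟧`-adic class of an element of `𝐇¹_Γ(T_pW)` —
# from the norm-compatible reductions `(red_{p^k,n} x)_n ∈ lim←_n H¹(ℚ_n, W[p^k])` to the compatible
# family of the `T`-adic tower `lim←_J H¹(ℚ, 𝒯_J^{(k)}(E))`, and its reduction to the mod-`p` class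
# (definitions + proofs; no fact)

Topic `NumberTheory/EllipticCurves`, sub-directory `Kato2004`.  Cell `bsd-f3-mu` (crux `KatoDivisibilityX9`
= item stmt-BirchSwinnertonDyer-20547, line `graded_euler_loss`, stub `stub_depthX9`), typing ask
**T-es-6 (c)** part 2 (definition item `defn-IwasawaH1.redTowerPk`; part 1 = `IwasawaTwistModPkTower`):
the level-`p^k` twin of `Kato2004/IwasawaH1ReductionTower.lean` (`redTower`, the case `k = 1`), i.e. the
GLUE of the tree's `Kato2004/IwasawaH1ReductionPk.lean` (`IwasawaH1Data.redPk k : 𝐇¹_Γ(T_pW) →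
lim←_n H¹(ℚ_n, W[p^k])`, cell `bsd-cn100`) with the level-`p^k` inverse Shapiro maps `coresShapiroPk`
of part 1.  The value `red_Ω^{(k)} s'` is the carrier of the transverse VALUE of MEMO-es §25.2 (d)
(consumers: stubs S1/S2/S4 of `stub_depthX9`).  DEFINITIONS WITH BODIES AND PROOFS ONLY; no named fact
is introduced (the one named fact USED, as a hypothesis, is the tree's `mem_pSmul_of_red_eq_zero`).

* §1 (any `p^k`-torsion discrete `T` over `ℚ`) **`towerOfNormCompatiblePk T hM κ y hy : κ.twistTowerPk T hM`**
  — the compatible family `J ↦ coresShapiroPk (J+k) J (y_{J+k})` (layer `J + k` is admissible for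
  level `J`: `J ≤ p^{(J+k)+1−k}`) attached to a norm-compatible family `y` (compatibility:
  `truncH1Pk_coresShapiroPk`, `coresShapiroPk_eq_of_le`, `coresLe_eq_of_layerCores_eq`);
  `towerOfNormCompatiblePk_apply`, and `…_apply_eq_of_level` (ANY admissible layer `N` computes the
  `J`-th component).
* §2 **`IwasawaH1Data.redTowerPk I k : I.H →+ κ.twistTowerPk (W.torsionGaloisModule ((p:ℤ)^k)) _`** —
  `x ↦ (coresShapiroPk (J+k) J (red_{p^k,J+k} (proj_{J+k} x)))_J`, additive; `redTowerPk_apply_coe`,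
  `redTowerPk_apply_coe_eq_of_level`, `redTowerPk_C_pow_smul` (`(p^k) · 𝐇¹ ↦ 0`).
* §3 **Reduction to the mod-`p` class.**  `WeierstrassCurve.geomTorsionPowToModP W p k : E[p^{k+1}] → E[p]`,
  `P ↦ p^k • P` (additive, `Γ`-equivariant; `torsionPowToModP` as a continuous intertwining map),
  `pow_zsmul_coe_tateModPk_succ` (`p^k • a_{k+1} = a_1` on the Tate module),
  `cohomologyMap_reduceH1Pk_succ_eq_reduceH1` (`(p^k•)_* ∘ red_{p^{k+1}} = red` on `H¹(Γ_n, ·)`), the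
  model's component formula at any layer `redTower_apply_coe_eq_of_le`, and
  **`twistTowerPkToModP_redTowerPk`: the levelwise image of `red_Ω^{(k+1)} x` under `(p^k•)_*` IS the
  mod-`p` class `redTower x`**; hence `redTowerPk_ne_zero_of_redTower_ne_zero` and, under Kato's
  `𝐇¹/p ⊂ 𝐇¹(T/p)` (`mem_pSmul_of_red_eq_zero`, hypothesis), **`redTowerPk_ne_zero_of_not_mem`**:
  `s ∉ (p)•𝐇¹ ⟹ red_Ω^{(k+1)} s ≠ 0`.

Not here: injectivity of the level-`p^k` inverse Shapiro maps / `red_Ω^{(k)} x = 0 ↔ red_{p^k} x = 0`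
(at level `p^k` the `T`-adic and the `ω`-adic towers are only cofinal; not needed by the consumers).

## References

* K. Kato, Astérisque 295 (2004), §12.2 (p. 220), §13.8 (pp. 228–229: "`𝐇^q(T) = lim←_n H^q(ℤ[1/p],
  T ⊗ O_λ[G_n])`", "`𝐇¹(T)/x𝐇¹(T) ⊂ H¹(ℤ[1/p], T ⊗ Λ/xΛ)`" with `x = p^k`). [Kato2004Asterisque]
* B. Perrin-Riou, Bull. SMF 115 (1987) §0 (transition maps induced by multiplication by `p`). [PerrinRiou1987BSMF]
* J.-P. Serre, *Galois Cohomology* (1997), I §2.5. [SerreGaloisCohomology1997]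
* B. Mazur, K. Rubin, *Kolyvagin systems* (2004), §5.3. [MazurRubin2004]
-/

noncomputable section

open scoped NumberField ContRepresentation
open Field CategoryTheory
open Literature.NumberTheory.GaloisRepresentations
open Literature.NumberTheory.EllipticCurves Literature.NumberTheory.EllipticCurves.Kato2004
open Literature.NumberTheory.EllipticCurves.Kato2004.EulerSystemValues
open WeierstrassCurve (geomPoints geomTorsion)

universe u

namespace Literature.NumberTheory.EllipticCurves.Kato2004

/-! ## §1 From norm-compatible families to the level-`p^k` `T`-adic tower -/

section General

variable {M : Type} [AddCommGroup M] [TopologicalSpace M] [DiscreteTopology M]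
  (T : DiscreteGaloisModule ℚ M) {p : ℕ} [Fact p.Prime] {k : ℕ} (hM : ∀ x : M, p ^ k • x = 0)
  (κ : ZpExtension ℚ p)

/-- Layer `N` is admissible for level `J` as soon as `J + k ≤ N + 1` (`N + 1 - k < p^{N+1-k}`); private
helper. [folklore] -/
private theorem adm {J N : ℕ} (h : J + k ≤ N + 1) : J ≤ p ^ (N + 1 - k) :=
  (show J ≤ N + 1 - k by omega).trans (Nat.lt_pow_self (Fact.out : p.Prime).one_lt).le

/-- **The compatible family of the level-`p^k` `T`-adic tower attached to a norm-compatible family**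
`y = (y_n)_n ∈ lim←_n H¹(ℚ_n, M)`: `J ↦ coresShapiroPk (J+k) J (y_{J+k}) ∈ H¹(ℚ, 𝒯_J^{(k)})` (layer `J + k`
is admissible for level `J`).  Compatibility under truncation `J' ≤ J`: `truncH1Pk_coresShapiroPk`
(truncation in `J`), `coresShapiroPk_eq_of_le` (descend the layer from `J + k` to `J' + k` along the trace)
and `coresLe_eq_of_layerCores_eq` (norm-compatibility).  This is Kato's
`𝐇¹(T/p^k) = lim←_n H¹(ℤ[1/p], T/p^k ⊗ ℤ/p^k[G_n])` read in the `T`-adic tower.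
[cite: Kato2004Asterisque, §13.8 (p. 228)] [cite: SerreGaloisCohomology1997, I §2.5 Prop. 10] -/
def towerOfNormCompatiblePk (y : ∀ n : ℕ, H1 T (κ.layerSubgroup n))
    (hy : ∀ n, layerCores T κ n (y (n + 1)) = y n) : κ.twistTowerPk T hM :=
  ⟨fun J ↦ haveI := κ.fintypeQuotientLayer (J + k);
      κ.coresShapiroPk T hM J (J + k) (adm (Nat.le_succ _)) (y (J + k)), by
    intro J J' h
    letI := κ.fintypeQuotientLayer (J + k)
    letI := κ.fintypeQuotientLayer (J' + k)
    change κ.truncH1Pk T hM h (κ.coresShapiroPk T hM J (J + k) (adm (Nat.le_succ _)) (y (J + k))) =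
      κ.coresShapiroPk T hM J' (J' + k) (adm (Nat.le_succ _)) (y (J' + k))
    rcases h.eq_or_lt with rfl | hlt
    · exact κ.truncH1Pk_refl T hM _ _
    · letI := fintypeLayerQuotient κ (J' + k) (J + k)
      rw [κ.truncH1Pk_coresShapiroPk T hM J (J + k) h (adm (Nat.le_succ _)) (adm (by omega)),
        κ.coresShapiroPk_eq_of_le T hM J' (Nat.add_le_add_right h k) (adm (Nat.le_succ _)) (adm (by omega)),
        coresLe_eq_of_layerCores_eq T κ y hy (Nat.add_lt_add_right hlt k)]⟩

/-- The `J`-th component of `towerOfNormCompatiblePk`: `coresShapiroPk (J+k) J (y_{J+k})`.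
[cite: Kato2004Asterisque, §13.8 (p. 228)] -/
theorem towerOfNormCompatiblePk_apply (y : ∀ n : ℕ, H1 T (κ.layerSubgroup n))
    (hy : ∀ n, layerCores T κ n (y (n + 1)) = y n) (J : ℕ) :
    (towerOfNormCompatiblePk T hM κ y hy : ∀ J : ℕ, galoisCohomology (κ.twistModPk T hM J) 1) J =
      (haveI := κ.fintypeQuotientLayer (J + k);
        κ.coresShapiroPk T hM J (J + k) (adm (Nat.le_succ _)) (y (J + k))) := rfl

/-- **Any admissible layer computes the `J`-th component**: for `J ≤ p^{N+1−k}`,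
`(towerOfNormCompatiblePk y)_J = coresShapiroPk N J (y_N)` (change of layer along the traces in either
direction). [cite: Kato2004Asterisque, §12.2 (p. 220) and §13.8 (p. 228)] -/
theorem towerOfNormCompatiblePk_apply_eq_of_level (y : ∀ n : ℕ, H1 T (κ.layerSubgroup n))
    (hy : ∀ n, layerCores T κ n (y (n + 1)) = y n) (J : ℕ) {N : ℕ} (hN : J ≤ p ^ (N + 1 - k))
    [inst : Fintype (absoluteGaloisGroup ℚ ⧸ κ.layerSubgroup N)] :
    (towerOfNormCompatiblePk T hM κ y hy : ∀ J : ℕ, galoisCohomology (κ.twistModPk T hM J) 1) J =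
      κ.coresShapiroPk T hM J N hN (y N) := by
  rw [towerOfNormCompatiblePk_apply]
  -- compare through the traces between the layers `N` and `J + k`, in whichever direction applies
  rcases lt_trichotomy N (J + k) with hlt | rfl | hgt
  · letI := κ.fintypeQuotientLayer (J + k)
    letI := fintypeLayerQuotient κ N (J + k)
    rw [κ.coresShapiroPk_eq_of_le T hM J hlt.le hN (adm (Nat.le_succ _)),
      coresLe_eq_of_layerCores_eq T κ y hy hlt]
  · have hi : inst = κ.fintypeQuotientLayer (J + k) := Subsingleton.elim _ _
    subst hi
    rfl
  · letI := κ.fintypeQuotientLayer (J + k)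
    letI := fintypeLayerQuotient κ (J + k) N
    rw [κ.coresShapiroPk_eq_of_le T hM J hgt.le (adm (Nat.le_succ _)) hN,
      coresLe_eq_of_layerCores_eq T κ y hy hgt]

end General

/-! ## §2 The level-`p^k` `Ω`-adic class of an element of the pinned `𝐇¹_Γ(T_pW)` -/

namespace IwasawaH1Data

variable {W : WeierstrassCurve ℚ} [W.IsElliptic] {p : ℕ} [Fact p.Prime]
  [ContinuousSMul ℤ_[p] (W.tateModule p)] {κ : ZpExtension ℚ p} {γ : absoluteGaloisGroup ℚ}
  (I : IwasawaH1Data W p κ γ) (k : ℕ)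

/-- **The level-`p^k` `Ω`-adic class `red_Ω^{(k)} : 𝐇¹_Γ(T_pW) → lim←_J H¹(ℚ, 𝒯_J^{(k)}(E))`**: reduce modulo
`p^k` levelwise (`I.redPk k`, a norm-compatible family of `∏_n H¹(ℚ_n, W[p^k])`, tree
`Kato2004/IwasawaH1ReductionPk`), then pass to the `T`-adic tower through the level-`p^k` inverse Shapiro
maps (`towerOfNormCompatiblePk`).  Additive.  For `k = 1` compare `IwasawaH1Data.redTower`.
[cite: Kato2004Asterisque, §13.8 (pp. 228–229)] -/
def redTowerPk :
    I.H →+ κ.twistTowerPk (W.torsionGaloisModule ((p : ℤ) ^ k)) (W.pow_nsmul_geomTorsion_eq_zero p k) where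
  toFun x := towerOfNormCompatiblePk (W.torsionGaloisModule ((p : ℤ) ^ k))
    (W.pow_nsmul_geomTorsion_eq_zero p k) κ (I.redPk k x) (fun n ↦ (I.isNormCompatible_redPk k x).2 n)
  map_zero' := by
    refine Subtype.ext (funext fun J ↦ ?_)
    rw [towerOfNormCompatiblePk_apply, map_zero, Pi.zero_apply, map_zero]
    rfl
  map_add' x x' := by
    refine Subtype.ext (funext fun J ↦ ?_)
    rw [AddSubgroup.coe_add, Pi.add_apply, towerOfNormCompatiblePk_apply, towerOfNormCompatiblePk_apply,
      towerOfNormCompatiblePk_apply, map_add, Pi.add_apply, map_add]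

/-- Components of `redTowerPk`: `(red_Ω^{(k)} x)_J = coresShapiroPk (J+k) J (red_{p^k,J+k} (proj_{J+k} x))`.
[cite: Kato2004Asterisque, §13.8 (p. 228)] -/
theorem redTowerPk_apply_coe (x : I.H) (J : ℕ) :
    (I.redTowerPk k x : ∀ J : ℕ, galoisCohomology (κ.twistModPk (W.torsionGaloisModule ((p : ℤ) ^ k))
      (W.pow_nsmul_geomTorsion_eq_zero p k) J) 1) J =
      (haveI := κ.fintypeQuotientLayer (J + k);
        κ.coresShapiroPk (W.torsionGaloisModule ((p : ℤ) ^ k)) (W.pow_nsmul_geomTorsion_eq_zero p k) J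
          (J + k) (adm (Nat.le_succ _)) (reduceH1Pk W p k (κ.layerSubgroup (J + k)) (I.proj (J + k) x))) := rfl

/-- **Any admissible layer computes the `J`-th component of `red_Ω^{(k)} x`**: for `J ≤ p^{N+1−k}`,
`(red_Ω^{(k)} x)_J = coresShapiroPk N J (red_{p^k,N} (proj_N x))`.
[cite: Kato2004Asterisque, §12.2 (p. 220) and §13.8 (p. 228)] -/
theorem redTowerPk_apply_coe_eq_of_level (x : I.H) (J : ℕ) {N : ℕ} (hN : J ≤ p ^ (N + 1 - k))
    [Fintype (absoluteGaloisGroup ℚ ⧸ κ.layerSubgroup N)] :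
    (I.redTowerPk k x : ∀ J : ℕ, galoisCohomology (κ.twistModPk (W.torsionGaloisModule ((p : ℤ) ^ k))
      (W.pow_nsmul_geomTorsion_eq_zero p k) J) 1) J =
      κ.coresShapiroPk (W.torsionGaloisModule ((p : ℤ) ^ k)) (W.pow_nsmul_geomTorsion_eq_zero p k) J N hN
        (reduceH1Pk W p k (κ.layerSubgroup N) (I.proj N x)) :=
  towerOfNormCompatiblePk_apply_eq_of_level _ _ κ _ (fun n ↦ (I.isNormCompatible_redPk k x).2 n) J hN

/-- `red_Ω^{(k)}` kills `p^k · 𝐇¹_Γ(T_pW)` (`redPk_C_pow_smul`). [cite: Kato2004Asterisque, §13.8 (p. 228)] -/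
theorem redTowerPk_C_pow_smul (x : I.H) :
    I.redTowerPk k (PowerSeries.C ((p : ℤ_[p]) ^ k) • x) = 0 := by
  refine Subtype.ext (funext fun J ↦ ?_)
  rw [redTowerPk_apply_coe, ← redPk_apply, I.redPk_C_pow_smul k x, Pi.zero_apply, map_zero,
    ZeroMemClass.coe_zero, Pi.zero_apply]

end IwasawaH1Data

/-! ## §3 Reduction of the level-`p^{k+1}` class to the mod-`p` class -/

end Literature.NumberTheory.EllipticCurves.Kato2004

namespace WeierstrassCurve

open Literature.NumberTheory.EllipticCurves Literature.NumberTheory.GaloisRepresentations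

variable {F : Type u} [Field F] (W : WeierstrassCurve F) (p : ℕ) (k : ℕ)

/-- **`E[p^{k+1}] → E[p]`, `P ↦ p^k • P`** (the reduction `T/p^{k+1} → T/p` of Kato §13.8 read on torsion
points; Perrin-Riou's transition maps "induits par la multiplication par `p`", iterated). Additive.
[cite: PerrinRiou1987BSMF, §0 (p. 401)] -/
def geomTorsionPowToModP : geomTorsion W ((p : ℤ) ^ (k + 1)) →+ geomTorsion W (p : ℤ) where
  toFun P := ⟨((p : ℤ) ^ k) • (P : geomPoints W), by
    have hP : ((p : ℤ) ^ (k + 1)) • (P : geomPoints W) = 0 :=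
      (Submodule.mem_torsionBy_iff _ _).mp P.2
    exact (Submodule.mem_torsionBy_iff _ _).mpr (by rw [smul_smul, ← pow_succ', hP])⟩
  map_zero' := Subtype.ext (by
    change ((p : ℤ) ^ k) • ((0 : geomTorsion W ((p : ℤ) ^ (k + 1))) : geomPoints W) = 0
    rw [ZeroMemClass.coe_zero, smul_zero])
  map_add' P Q := Subtype.ext (by
    change ((p : ℤ) ^ k) • ((P + Q : geomTorsion W ((p : ℤ) ^ (k + 1))) : geomPoints W) =
      ((p : ℤ) ^ k) • (P : geomPoints W) + ((p : ℤ) ^ k) • (Q : geomPoints W)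
    rw [AddMemClass.coe_add, smul_add])

/-- Values of `geomTorsionPowToModP` on points: `p^k • P`. [cite: PerrinRiou1987BSMF, §0 (p. 401)] -/
@[simp]
theorem coe_geomTorsionPowToModP (P : geomTorsion W ((p : ℤ) ^ (k + 1))) :
    ((W.geomTorsionPowToModP p k P : geomTorsion W (p : ℤ)) : geomPoints W) =
      ((p : ℤ) ^ k) • (P : geomPoints W) := rfl

/-- `geomTorsionPowToModP` is `Γ_F`-equivariant (the Galois action commutes with multiplication by
`p^k`). [cite: PerrinRiou1987BSMF, §0 (p. 401)] -/
theorem geomTorsionPowToModP_smul (σ : absoluteGaloisGroup F) (P : geomTorsion W ((p : ℤ) ^ (k + 1))) :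
    W.geomTorsionPowToModP p k (σ • P) = σ • W.geomTorsionPowToModP p k P := by
  apply Subtype.ext
  rw [coe_geomTorsionPowToModP, AddSubgroup.torsionBy.coe_smul, AddSubgroup.torsionBy.coe_smul,
    coe_geomTorsionPowToModP]
  exact (map_zsmul (DistribSMul.toAddMonoidHom (geomPoints W) σ) ((p : ℤ) ^ k) (P : geomPoints W)).symm

/-- **`E[p^{k+1}] → E[p]`, `P ↦ p^k • P`, as a continuous intertwining map** of the discrete Galois modules
`W.torsionGaloisModule ((p:ℤ)^(k+1)) → W.torsionGaloisModule (p:ℤ)` (the shape consumed by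
`ZpExtension.twistModPkToModP` / `twistTowerPkToModP`). [cite: PerrinRiou1987BSMF, §0 (p. 401)] -/
def torsionPowToModP :
    (W.torsionGaloisModule ((p : ℤ) ^ (k + 1))).toContRepresentation →ⁱL
      (W.torsionGaloisModule (p : ℤ)).toContRepresentation where
  toContinuousLinearMap :=
    { toFun := W.geomTorsionPowToModP p k
      map_add' := map_add _
      map_smul' := fun c P ↦ by rw [map_zsmul, RingHom.id_apply]
      cont := continuous_of_discreteTopology }
  isIntertwining' σ := by
    refine ContinuousLinearMap.ext fun P ↦ ?_
    exact W.geomTorsionPowToModP_smul p k σ P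

/-- Unfolding `torsionPowToModP`. [cite: PerrinRiou1987BSMF, §0 (p. 401)] -/
@[simp] theorem torsionPowToModP_apply (P : geomTorsion W ((p : ℤ) ^ (k + 1))) :
    W.torsionPowToModP p k P = W.geomTorsionPowToModP p k P := rfl

end WeierstrassCurve

namespace Literature.NumberTheory.EllipticCurves.Kato2004

section ToModP

variable (W : WeierstrassCurve ℚ) [W.IsElliptic] (p : ℕ) [Fact p.Prime] (k : ℕ)

omit [W.IsElliptic] [Fact p.Prime] in
/-- **`p^k • a_{k+1} = a_1` on the Tate module** (iterate of `zsmul_coe_tateModPk_succ`, then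
`coe_tateModPk_one`): the reduction modulo `p^{k+1}` followed by `p^k •` is the reduction modulo `p`, on
points. [cite: PerrinRiou1987BSMF, §0 (p. 401)] [cite: Kato2004Asterisque, §13.8 (p. 228)] -/
theorem pow_zsmul_coe_tateModPk_succ (a : W.tateModule p) :
    ((p : ℤ) ^ k) • ((tateModPk W p (k + 1) a : geomTorsion W ((p : ℤ) ^ (k + 1))) : geomPoints W) =
      ((tateModP W p a : geomTorsion W (p : ℤ)) : geomPoints W) := by
  induction k with
  | zero => rw [pow_zero, one_smul, coe_tateModPk_one]
  | succ k ih => rw [pow_succ, mul_smul, zsmul_coe_tateModPk_succ, ih]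

variable [ContinuousSMul ℤ_[p] (W.tateModule p)]

/-- **`(p^k •)_* ∘ red_{p^{k+1}} = red` on `H¹(U, ·)`**: the map induced on `H¹(U, ·)` by
`E[p^{k+1}] → E[p]`, `P ↦ p^k • P` (in the `cohomologyMap`/`subgroupRepHom` currency of part 1) takes
`red_{p^{k+1}} c` to the mod-`p` reduction `reduceH1 W p U c` of `IwasawaH1Reduction.lean` — on cocycles
this is `p^k • a_{k+1} = a_1` componentwise. [cite: Kato2004Asterisque, §13.8 (p. 228)]
[cite: PerrinRiou1987BSMF, §0 (p. 401)] -/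
theorem cohomologyMap_reduceH1Pk_succ_eq_reduceH1 (U : Subgroup (absoluteGaloisGroup ℚ))
    (c : H1 (tateRep W p) U) :
    (cohomologyMap (subgroupRepHom (ZpExtension.topRepHomOf (W.torsionGaloisModule ((p : ℤ) ^ (k + 1)))
        (W.torsionGaloisModule (p : ℤ)) (W.torsionPowToModP p k)) U) 1).hom
        (reduceH1Pk W p (k + 1) U c) =
      reduceH1 W p U c := by
  obtain ⟨φ, rfl⟩ := oneCocycleClass_surjective _ c
  rw [reduceH1Pk_oneCocycleClass, reduceH1_oneCocycleClass, cohomologyMap_oneCocycleClass]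
  refine congrArg _ (Subtype.ext (ContinuousMap.ext fun g ↦ Subtype.ext ?_))
  rw [pullback_id_resIdHom_apply, subgroupRepHom_hom_apply, contOneCocycles.pushAddHom_apply,
    contOneCocycles.pushAddHom_apply]
  exact pow_zsmul_coe_tateModPk_succ W p k (φ.1 g)

end ToModP

/-! ### The mod-`p` tower read at any layer -/

section ModelLevel

variable {M : Type} [AddCommGroup M] [TopologicalSpace M] [DiscreteTopology M]
  (T : DiscreteGaloisModule ℚ M) {p : ℕ} [Fact p.Prime] (hM : ∀ x : M, p • x = 0)
  (κ : ZpExtension ℚ p)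

/-- **The `J`-th component of the mod-`p` `Ω`-adic class at any layer `N` with `J ≤ p^N`**:
`(towerOfNormCompatible y)_J = trunc_{J ← p^N} (Sh_N⁻¹ y_N)` (compatibility of the family between the
levels `J ≤ p^N`, and `towerOfNormCompatible_apply_pow`). [cite: Kato2004Asterisque, §13.8 (p. 228)]
[cite: SerreGaloisCohomology1997, I §2.5 (b)] -/
theorem towerOfNormCompatible_apply_eq_of_le (y : ∀ n : ℕ, H1 T (κ.layerSubgroup n))
    (hy : ∀ n, layerCores T κ n (y (n + 1)) = y n) {J N : ℕ} (h : J ≤ p ^ N) :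
    (towerOfNormCompatible T hM κ y hy : ∀ J : ℕ, galoisCohomology (κ.twistModP T hM J) 1) J =
      κ.truncH1 T hM h (haveI := κ.fintypeQuotientLayer N; κ.coresShapiro T hM N (y N)) := by
  rw [← towerOfNormCompatible_apply_pow T hM κ y hy N]
  exact ((towerOfNormCompatible T hM κ y hy).2 (p ^ N) J h).symm

end ModelLevel

namespace IwasawaH1Data

variable {W : WeierstrassCurve ℚ} [W.IsElliptic] {p : ℕ} [Fact p.Prime]
  [ContinuousSMul ℤ_[p] (W.tateModule p)] {κ : ZpExtension ℚ p} {γ : absoluteGaloisGroup ℚ}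
  (I : IwasawaH1Data W p κ γ) (k : ℕ)

/-- The `J`-th component of the mod-`p` class `red_Ω x = redTower x` at any layer `N` with `J ≤ p^N`:
`(red_Ω x)_J = trunc_{J ← p^N} (Sh_N⁻¹ (red_N (proj_N x)))`. [cite: Kato2004Asterisque, §13.8 (p. 228)] -/
theorem redTower_apply_coe_eq_of_le (x : I.H) {J N : ℕ} (h : J ≤ p ^ N) :
    (I.redTower x : ∀ J : ℕ, galoisCohomology (κ.twistModP (W.torsionGaloisModule (p : ℤ))
      torsion_nsmul_eq_zero J) 1) J =
      κ.truncH1 (W.torsionGaloisModule (p : ℤ)) torsion_nsmul_eq_zero h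
        (haveI := κ.fintypeQuotientLayer N;
          κ.coresShapiro (W.torsionGaloisModule (p : ℤ)) torsion_nsmul_eq_zero N
            (reduceH1 W p (κ.layerSubgroup N) (I.proj N x))) :=
  towerOfNormCompatible_apply_eq_of_le _ _ κ _ (fun n ↦ (I.isNormCompatible_red x).2 n) h

/-- **Reduction of the level-`p^{k+1}` `Ω`-adic class to the mod-`p` class**: under the levelwise map of
towers induced by `E[p^{k+1}] → E[p]`, `P ↦ p^k • P` (`twistTowerPkToModP` along `torsionPowToModP`),
`red_Ω^{(k+1)} x ↦ red_Ω x = redTower x`.  Componentwise at level `J` (layer `N = J + k + 1`):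
`(p^k•)_* coresShapiroPk N J (red_{p^{k+1},N} ·) = trunc_{J ← p^N} Sh_N⁻¹ ((p^k•)_* red_{p^{k+1},N} ·)`
(`map_toModP_coresShapiroPk`) `= trunc_{J ← p^N} Sh_N⁻¹ (red_N ·)`
(`cohomologyMap_reduceH1Pk_succ_eq_reduceH1`) `= (red_Ω x)_J` (`redTower_apply_coe_eq_of_le`).
[cite: Kato2004Asterisque, §13.8 (pp. 228–229)] -/
theorem twistTowerPkToModP_redTowerPk (x : I.H) :
    κ.twistTowerPkToModP (W.torsionGaloisModule ((p : ℤ) ^ (k + 1)))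
        (W.pow_nsmul_geomTorsion_eq_zero p (k + 1)) (W.torsionGaloisModule (p : ℤ)) torsion_nsmul_eq_zero
        (W.torsionPowToModP p k) (I.redTowerPk (k + 1) x) =
      I.redTower x := by
  refine Subtype.ext (funext fun J ↦ ?_)
  letI := κ.fintypeQuotientLayer (J + (k + 1))
  have hJN : J ≤ p ^ (J + (k + 1)) :=
    (Nat.le_add_right J (k + 1)).trans (Nat.lt_pow_self (Fact.out : p.Prime).one_lt).le
  rw [ZpExtension.twistTowerPkToModP_apply_coe, redTowerPk_apply_coe,
    κ.map_toModP_coresShapiroPk _ _ J (J + (k + 1)) _ _ (W.torsionPowToModP p k) _ hJN,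
    cohomologyMap_reduceH1Pk_succ_eq_reduceH1, I.redTower_apply_coe_eq_of_le x hJN]

/-- Hence **`red_Ω x ≠ 0 ⟹ red_Ω^{(k+1)} x ≠ 0`** (the mod-`p` class is an image of the level-`p^{k+1}` one).
[cite: Kato2004Asterisque, §13.8 (pp. 228–229)] -/
theorem redTowerPk_ne_zero_of_redTower_ne_zero {x : I.H} (hx : I.redTower x ≠ 0) :
    I.redTowerPk (k + 1) x ≠ 0 := by
  intro h0
  apply hx
  rw [← I.twistTowerPkToModP_redTowerPk k x, h0, map_zero]

/-- **MEMO-es §25.2 (d) at level `p^{k+1}`, "`red_Ω^{(k+1)} s' ≠ 0`"**: under Kato's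
`𝐇¹(T)/p𝐇¹(T) ⊂ 𝐇¹(T/p)` (the tree's named fact `mem_pSmul_of_red_eq_zero`, a hypothesis here), an element
`s ∉ (p) • 𝐇¹_Γ(T_pW)` has NON-ZERO level-`p^{k+1}` `Ω`-adic class (through the mod-`p` class,
`redTower_ne_zero_of_not_mem`). [cite: Kato2004Asterisque, §13.8 (pp. 228–229)] -/
theorem redTowerPk_ne_zero_of_not_mem (h : mem_pSmul_of_red_eq_zero) (hκ : κ.IsCyclotomic)
    (hγ : κ.IsTopGenerator γ) {s : I.H}
    (hs : s ∉ (IwasawaAlgebra.augIdealP p) • (⊤ : Submodule (IwasawaAlgebra p) I.H)) :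
    I.redTowerPk (k + 1) s ≠ 0 :=
  I.redTowerPk_ne_zero_of_redTower_ne_zero k (I.redTower_ne_zero_of_not_mem h hκ hγ hs)

end IwasawaH1Data

end Literature.NumberTheory.EllipticCurves.Kato2004

end
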